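import Literature.Analysis.FluidPDE.FluidComputer.ThresholdLevelTableW
import HarnessLib

/-!
# Kernel run of the level-table checker over the gate-data box, chunks 4 … 7 (bp3 gen 13, layer 4: robustness variant)

HONEST FRAMING: low prior, high value-of-information experiment on Tao's machine paradigm; NOT a
claim that NS blows up.

Four kernel evaluations (`decide +kernel`; no `native_decide`, no extra axioms) of `runSteps`
with the interval gate data `GIw` (all couplings within relative `10⁻³`, `δ ∈ [0, 1.001 δ₀]`),
25 steps each, from `Bw4` to `Bw8`.
-/

namespace Literature.Analysis.FluidPDE.FluidComputer

namespace ThresholdLevelTable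

set_option maxHeartbeats 10000000 in
set_option maxRecDepth 200000 in
/-- Chunk 4 of the data-box table run (steps 100 … 124). [folklore] -/
theorem runW4 : runSteps 60 12 3 GIw RbIt Bw4 chunk4 1124126418046697 = some Bw5 := by
  decide +kernel

set_option maxHeartbeats 10000000 in
set_option maxRecDepth 200000 in
/-- Chunk 5 of the data-box table run (steps 125 … 149). [folklore] -/
theorem runW5 : runSteps 60 12 3 GIw RbIt Bw5 chunk5 1337894513896634 = some Bw6 := by
  decide +kernel

set_option maxHeartbeats 10000000 in
set_option maxRecDepth 200000 in
/-- Chunk 6 of the data-box table run (steps 150 … 174). [folklore] -/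
theorem runW6 : runSteps 60 12 3 GIw RbIt Bw6 chunk6 1592313552620694 = some Bw7 := by
  decide +kernel

set_option maxHeartbeats 10000000 in
set_option maxRecDepth 200000 in
/-- Chunk 7 of the data-box table run (steps 175 … 199). [folklore] -/
theorem runW7 : runSteps 60 12 3 GIw RbIt Bw7 chunk7 1895113869982896 = some Bw8 := by
  decide +kernel

end ThresholdLevelTable

end Literature.Analysis.FluidPDE.FluidComputer
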